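import Literature.NumberTheory.LFunctions.ConreyIwaniec2002BottomPointwise
import Literature.NumberTheory.LFunctions.ConreyIwaniec2002PrincipalEstimate
import HarnessLib

/-!
# Conrey–Iwaniec (2002), Proposition 9.1 in the `_large` form OF RECORD, from Proposition 6.4

B. Conrey, H. Iwaniec, *Spacing of zeros of Hecke L-functions and the class number problem*,
Acta Arith. 103 (2002), §§5–9 [held text `paper:arxiv-math_0111012`, p0013–p0020]: Proposition 9.1
(9.7), `E(T) ≪ T(log q)^6 + Tℒ(T)^{1/2}(log T)²(log q)^{5/2}` for `1`-spaced points `T < t ≤ 2T`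
with arbitrary companions; §8 p. 18: "For the time being we assume that `T ≥ q^{65}` to comply with
the condition of Proposition 6.4".

THIS FILE proves `prop91_large_of_proposition64`: Proposition 9.1 (9.7) VERBATIM in the `_large`
range of record `q^{65} ≤ T`, `e^{(log q)²} ≤ T`, companions `t′ : ℝ → ℝ` arbitrary — the statement of
the binder S1 `stub_prop91_large` of SKELETON I6 (cell landau-siegel / ls-inputs) — from the typed
Proposition 6.4 (`conreyIwaniec2002_proposition64`, binder `h64`) ALONE. The tree had it only for
`2q^{66} ≤ T`, `2e^{(log q)²} ≤ T` (`prop91_unrestricted_of_proposition64`): the printed passage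
from the discrete mean value to the integral (Proposition 5.4) needs Proposition 6.4 at `T/2`.
The argument here is not the printed one:
* the points of `S` above `q^{65} + 2q + 2` are handled by the ONE-SIDED Proposition 5.4
  (`WeightedDiscreteMeanValueFloor`) and the floor pipeline (`…Prop81MeanSquaresFloor`,
  `…FloorClose`, `…Prop91Floor`): every window of Proposition 6.4 lies above `q^{65}`;
* the at most `2q + 4` points below are present only when `T < 2q^{65}` (so `log T ≤ 66 log q`) and
  are bounded ONE BY ONE (`bottom_pointwise`: `|ℓM̄ − x| ≪ q³√T(log T)^6`, since `E(T)` is linear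
  in `ℓ`), for a total `≪ q⁴√T(log q)^6 ≤ T(log q)^6` as `q^8 ≤ T`; coincident companions by the
  limit `defectE_limit`.
No definition, no new named fact; `h64` is the only hypothesis.

«The programme SEARCHES and TYPES; no claim about Landau–Siegel zeros, Theorems 1–2 of
arXiv:2211.02515 or a repaired Margin232 until a kernel theorem says so.»

## References
* [ConreyIwaniec2002] B. Conrey, H. Iwaniec, Acta Arith. 103 (2002) 259–312, arXiv:math/0111012:
  Proposition 9.1 (9.7); §8 p. 18 L131–135; Propositions 5.4, 6.4, 8.1.
-/

noncomputable section

open scoped NumberField ComplexConjugate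
open Complex

namespace Literature.NumberTheory.LFunctions

namespace ConreyIwaniec2002

open NumberField

set_option maxHeartbeats 400000 in
/-- **CI PROPOSITION 9.1 (9.7) IN THE `_large` RANGE OF RECORD, FROM PROPOSITION 6.4.** For `q` odd
`> 4`, `χ` the real primitive character mod `q`, `K = ℚ(√−q)`, `ψ ∈ Ĉℓ(K)`, a `1`-spaced `S ⊂ (T, 2T]`
with `q^65 ≤ T`, `e^{(log q)²} ≤ T`, and ANY companion map `t′ : ℝ → ℝ`:
`E(T) = Σ_{t∈S} |ℓ(s)M̄(s) − x(s)| ≤ C·(T(log q)^6 + Tℒ(T)^{1/2}(log T)²(log q)^{5/2})` with one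
absolute `C` — VERBATIM the binder `stub_prop91_large` (S1) of SKELETON I6, modulo the typed
Proposition 6.4 only. [cite: ConreyIwaniec2002, Proposition 9.1 (9.7)] -/
theorem prop91_large_of_proposition64 (h64 : conreyIwaniec2002_proposition64) :
    ∃ C : ℝ, 0 < C ∧
    ∀ (q : ℕ) [NeZero q], 4 < q → Odd q → ∀ χ : DirichletCharacter ℂ q,
      χ.IsPrimitive → χ.IsQuadratic → χ.Odd →
        ∀ (K : Type) [Field K] [NumberField K],
          Module.finrank ℚ K = 2 → NumberField.discr K = -(q : ℤ) →
            ∀ (ψ : ClassGroup (𝓞 K) →* ℂˣ) (T : ℝ) (S : Finset ℝ) (t' : ℝ → ℝ),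
              (q : ℝ) ^ (65 : ℕ) ≤ T → Real.exp (Real.log q ^ (2 : ℕ)) ≤ T → IsDyadicPointSet S T →
                defectE K ψ q S t' ≤
                  C * (T * Real.log q ^ (6 : ℕ) +
                    T * Real.sqrt (calL χ T) * Real.log T ^ (2 : ℕ) * Real.log q ^ ((5 : ℝ) / 2)) := by
  obtain ⟨CH, hCH, hhigh⟩ := prop91_floor_of_proposition64 h64
  obtain ⟨CP, hCP, hpt⟩ := bottom_pointwise
  refine ⟨CH + 6 * 66 ^ 6 * CP, by positivity,
    fun q _ hq hodd χ hprim hquad hoddχ K _ _ h2 hdisc ψ T S t' hT hexpT hS => ?_⟩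
  classical
  -- numerics
  have hq0 : 0 < q := by omega
  have hq5 : (5 : ℝ) ≤ q := by exact_mod_cast hq
  have hq1 : (1 : ℝ) ≤ q := by linarith
  have hqpos : (0 : ℝ) < q := by linarith
  obtain ⟨hℓ1, -, hLT1, hℓle, hq41, -, hT3, -, -, -, -, hqT⟩ := prop81_numerics65 hq hT
  have hT0 : 0 < T := by linarith
  set F : ℝ := (q : ℝ) ^ (65 : ℕ) with hF
  have hF0 : 0 < F := by positivity
  set ℓ : ℝ := Real.log q with hℓ
  set LT : ℝ := Real.log T with hLT
  set cLT : ℝ := calL χ T with hcLT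
  have hℓ0 : 0 ≤ ℓ := by linarith
  have hcLT0 : 0 ≤ cLT := calL_nonneg χ (by linarith)
  set Y : ℝ := T * ℓ ^ (6 : ℕ) + T * Real.sqrt cLT * LT ^ (2 : ℕ) * ℓ ^ ((5 : ℝ) / 2) with hY
  have hY0 : 0 ≤ Y := by positivity
  have hTY : T * ℓ ^ (6 : ℕ) ≤ Y := by
    have : 0 ≤ T * Real.sqrt cLT * LT ^ (2 : ℕ) * ℓ ^ ((5 : ℝ) / 2) := by positivity
    rw [hY]; linarith
  -- split `S` at the height `q^65 + 2q + 2`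
  set c₂ : ℝ := F + 2 * q + 2 with hc₂
  set Sh := S.filter (fun t => c₂ ≤ t) with hSh
  set Sl := S.filter (fun t => ¬ c₂ ≤ t) with hSl
  have hsplit : defectE K ψ q S t' = defectE K ψ q Sh t' + defectE K ψ q Sl t' := by
    unfold defectE
    exact (Finset.sum_filter_add_sum_filter_not S _ _).symm
  have hShS : Sh ⊆ S := Finset.filter_subset _ _
  have hSlS : Sl ⊆ S := Finset.filter_subset _ _
  -- (1) the points above `q^65 + 2q + 2`: the floor pipeline
  have hhi : defectE K ψ q Sh t' ≤ CH * Y :=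
    hhigh q hq hodd χ hprim hquad hoddχ K h2 hdisc ψ T Sh t' hT hexpT (hS.subset hShS)
      (fun t ht => by have := (Finset.mem_filter.1 ht).2; rw [hc₂] at this; linarith)
  -- (2) the points below: at most `2q + 4` of them, each `≪ q³√T(log T)^6`
  have hcardl : (Sl.card : ℝ) ≤ 2 * q + 4 := by
    -- shift to `[2, 2q + 4]` and count with `IsPointSet.card_le'`
    set g : ℝ → ℝ := fun t => t - T + 2 with hg
    have hginj : Function.Injective g := fun a b h => by simpa [hg] using h
    have hPS : IsPointSet (Sl.image g) (2 * q + 4) := by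
      refine ⟨fun x hx => ?_, fun x hx y hy hxy => ?_⟩
      · obtain ⟨t, ht, rfl⟩ := Finset.mem_image.mp hx
        have htS := hS.mem_bounds (hSlS ht)
        have htc : t < c₂ := not_le.mp (Finset.mem_filter.1 ht).2
        simp only [hg]
        constructor
        · linarith [htS.1]
        · rw [hc₂] at htc; linarith
      · obtain ⟨t, ht, rfl⟩ := Finset.mem_image.mp hx
        obtain ⟨u, hu, rfl⟩ := Finset.mem_image.mp hy
        have htu : t ≠ u := fun e => hxy (by rw [e])
        have := hS.2 t (hSlS ht) u (hSlS hu) htu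
        simp only [hg]
        rwa [show t - T + 2 - (u - T + 2) = t - u by ring]
    have h := hPS.card_le' (by linarith)
    rwa [Finset.card_image_of_injective _ hginj] at h
  have hlo : defectE K ψ q Sl t' ≤ 6 * 66 ^ 6 * CP * Y := by
    rcases Sl.eq_empty_or_nonempty with h0 | ⟨t₀, ht₀⟩
    · rw [h0]; unfold defectE; rw [Finset.sum_empty]; positivity
    -- the regime: `T < 2q^65`, hence `log T ≤ 66 log q`
    have ht₀S := hS.mem_bounds (hSlS ht₀)
    have ht₀c : t₀ < c₂ := not_le.mp (Finset.mem_filter.1 ht₀).2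
    have hT2F : T < 2 * F := by
      have hq65 : 2 * (q : ℝ) + 2 ≤ F := by
        have : (q : ℝ) * 5 ≤ F := by
          calc (q : ℝ) * 5 ≤ (q : ℝ) * q := by gcongr
            _ = (q : ℝ) ^ 2 := by ring
            _ ≤ F := pow_le_pow_right₀ hq1 (by norm_num)
        linarith
      rw [hc₂] at ht₀c
      linarith [ht₀S.1]
    have hlogT66 : LT ≤ 66 * ℓ := by
      have h1 : LT ≤ Real.log (2 * F) := Real.log_le_log hT0 hT2F.le
      have h2' : Real.log (2 * F) = Real.log 2 + 65 * ℓ := by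
        rw [Real.log_mul (by norm_num) hF0.ne', hF, Real.log_pow]; push_cast; ring
      have h3 : Real.log 2 ≤ ℓ := Real.log_le_log (by norm_num) (by linarith)
      linarith
    have hLT0 : 0 ≤ LT := by linarith
    -- `q⁴ √T ≤ T` from `q^8 ≤ T`
    have hq8T : (q : ℝ) ^ 8 ≤ T := le_trans (pow_le_pow_right₀ hq1 (by norm_num)) hT
    have hq4rT : (q : ℝ) ^ 4 * Real.sqrt T ≤ T := by
      have h1 : (q : ℝ) ^ 4 ≤ Real.sqrt T := by
        rw [show (q : ℝ) ^ 4 = Real.sqrt (((q : ℝ) ^ 4) ^ 2) by rw [Real.sqrt_sq (by positivity)]]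
        exact Real.sqrt_le_sqrt (by nlinarith)
      calc (q : ℝ) ^ 4 * Real.sqrt T ≤ Real.sqrt T * Real.sqrt T :=
            mul_le_mul_of_nonneg_right h1 (Real.sqrt_nonneg _)
        _ = T := Real.mul_self_sqrt hT0.le
    -- the bound for every perturbed companion map, then the limit
    have hSlpos : ∀ t ∈ Sl, 0 < t := fun t ht => by linarith [(hS.mem_bounds (hSlS ht)).1]
    refine defectE_limit ψ hq0 Sl hSlpos t' fun ε hε hε1 => ?_
    set tε : ℝ → ℝ := fun t => if t' t = t then t + ε else t' t with htε
    have hne : ∀ t, tε t ≠ t := by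
      intro t; simp only [htε]
      split_ifs with h
      · linarith
      · exact h
    have hpt' : ∀ t ∈ Sl, ‖dividedDifference (classGroupLFunction K ψ) (1 / 2 + t * I) (1 / 2 + tε t * I) *
          starRingEnd ℂ (shortInvSum K ψ q (1 / 2 + t * I)) - xQuot q (1 / 2 + t * I) (1 / 2 + tε t * I)‖ ≤
        CP * ((q : ℝ) ^ 3 * Real.sqrt T * LT ^ 6) := by
      intro t ht
      have htS := hS.mem_bounds (hSlS ht)
      exact hpt q hq hodd χ hprim hquad hoddχ K h2 hdisc ψ T t (tε t) hT htS.1 htS.2 (hne t)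
    calc defectE K ψ q Sl tε ≤ ∑ t ∈ Sl, CP * ((q : ℝ) ^ 3 * Real.sqrt T * LT ^ 6) := by
          unfold defectE; exact Finset.sum_le_sum hpt'
      _ = Sl.card * (CP * ((q : ℝ) ^ 3 * Real.sqrt T * LT ^ 6)) := by
          rw [Finset.sum_const, nsmul_eq_mul]
      _ ≤ (2 * q + 4) * (CP * ((q : ℝ) ^ 3 * Real.sqrt T * LT ^ 6)) :=
          mul_le_mul_of_nonneg_right hcardl (by positivity)
      _ ≤ (6 * q) * (CP * ((q : ℝ) ^ 3 * Real.sqrt T * (66 * ℓ) ^ 6)) := by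
          have h6q : 2 * (q : ℝ) + 4 ≤ 6 * q := by linarith
          have hl6 : LT ^ 6 ≤ (66 * ℓ) ^ 6 := pow_le_pow_left₀ hLT0 hlogT66 6
          gcongr
      _ = 6 * 66 ^ 6 * CP * (((q : ℝ) ^ 4 * Real.sqrt T) * ℓ ^ 6) := by ring
      _ ≤ 6 * 66 ^ 6 * CP * (T * ℓ ^ 6) := by gcongr
      _ ≤ 6 * 66 ^ 6 * CP * Y := mul_le_mul_of_nonneg_left hTY (by positivity)
  -- assemble
  rw [hsplit, add_mul]
  exact add_le_add hhi hlo

/-! ### Down the I6 chain by name: the principal estimate from Proposition 6.4 through S1 -/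

/-- **SKELETON I6 with S1 discharged by name: the principal estimate (9.12) with exponent `e` from
Proposition 6.4 and the cosmetic step at exponent `e`** — the tree's `principalEstimate_of e` fed with
`prop91_large_of_proposition64 h64` for its `h1` (at `e = 7/2` with the tree's `calL_le_of_small_weak`,
resp. `e = 3` with the printed (9.11), this is the tree's `proposition92_weak_of_proposition64` /
`proposition92_of_proposition64`, landed earlier through the close forms).
[cite: ConreyIwaniec2002, Proposition 9.2 (9.12)] -/
theorem principalEstimate_of_proposition64 (e : ℝ) (h64 : conreyIwaniec2002_proposition64)
    (h4 : ∃ C : ℝ, 0 < C ∧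
      ∀ (q : ℕ) [NeZero q], 4 < q → ∀ χ : DirichletCharacter ℂ q,
        χ.IsPrimitive → χ.IsQuadratic → χ.Odd → ∀ T : ℝ, 2 ≤ T →
          Real.log T * Real.sqrt ‖χ.LFunction 1‖ * Real.log q ^ e ≤ 1 →
            calL χ T ≤ C * (‖χ.LFunction 1‖ * Real.log q ^ (2 * e - 5))) :
    ∃ C : ℝ, 0 < C ∧
    ∀ (q : ℕ) [NeZero q], 4 < q → Odd q → ∀ χ : DirichletCharacter ℂ q,
      χ.IsPrimitive → χ.IsQuadratic → χ.Odd →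
        ∀ (K : Type) [Field K] [NumberField K],
          Module.finrank ℚ K = 2 → NumberField.discr K = -(q : ℤ) →
            ∀ (ψ : ClassGroup (𝓞 K) →* ℂˣ) (T : ℝ) (S : Finset ℝ) (t' : ℝ → ℝ),
              2 ≤ T → IsPointSet S T →
                ∑ t ∈ S, sincTerm t (t' t) ≤
                  C * (T / Real.log T * Real.log q ^ (6 : ℕ) +
                    T * Real.log T * Real.sqrt ‖χ.LFunction 1‖ * Real.log q ^ e +
                    Real.log q ^ ((5 : ℝ) / 2) / Real.log T *
                      Real.sqrt (T * ∑ t ∈ S, ‖dividedDifference (classGroupLFunction K ψ)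
                        (1 / 2 + t * I) (1 / 2 + t' t * I)‖ ^ 2)) :=
  principalEstimate_of e (prop91_large_of_proposition64 h64) h4

end ConreyIwaniec2002

end Literature.NumberTheory.LFunctions

end
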